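import Summits.CriticalPhenomena.CardyFormulaZ2.Theses.CardyExpCovariance
import Summits.CriticalPhenomena.CardyFormulaZ2.Theorems.CardySelfRefinementLagHandOffDiscretisable
import Literature.Probability.Percolation.InterfaceScalingLimitDiscretised
import Literature.Probability.Percolation.BondInterfaceMeasurability
import Literature.Probability.RandomPlanarGeometry.ChordalCurveFamily
import Literature.Probability.RandomPlanarGeometry.SLEUniquenessInLaw
import Literature.Probability.RandomPlanarGeometry.StopAtShrinking
import Literature.Probability.RandomPlanarGeometry.LocalMartingaleProofs

/-!
# Birth skeleton (BC3) for piece X₃ `SeqLimitTargetIndependent` of the split of `CardyRigiditySeq` (stmt-CriticalPhenomena-4680)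

Route `CardyExpCovariance`; the piece is a child of the crux `CardyRigiditySeq` in the
strategist's children.json (the route decl does not exist yet, so it is restated verbatim here).

    SeqLimitTargetIndependent := ∀ u κ, 0 < κ → u_k → 0⁺ → LIMSEQ κ u →
      ∃ Q : ChordalFamily, (∀ D, IsSLELaw κ D (Q D)) ∧ Q.IsTargetIndependent

"locality of percolation, in Lawler–Schramm–Werner's SPLITTING form, survives the sequential
scaling limit".  Cut along lattice / limit:

* `stub_handsOffThickSplitting` (LATTICE, exact; size M/L): every three-marked domain
  `(D; a, b, b')` carries a HANDS-OFF PAIR of admissible discretisation families `E₁` of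
  `(D; a, b)` and `E₂` of `(D; a, b')` — identical except on the stretch `[b, b']` — whose
  interfaces, stopped on the closed `r`-neighbourhood of `[b, b'] = D.arc 1`, have the SAME LAW at
  every small mesh (the two explorations coincide edge by edge until they first examine a boundary
  edge of `[b, b']`, by which time both are inside the neighbourhood; cf. the `LagHandOff`
  machinery of route `CardySelfRefinement`).
* `stub_stoppedLawsConverge` (LIMIT; size L, pure curve-space measure theory): if the interfaces
  of an admissible family converge in law along `u` to a random curve `Γ`, then for every closed
  `F` and Lebesgue-a.e. radius `r > 0` the curves stopped on `cthickening r F` converge in law to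
  `stopAt (cthickening r F) ∘ Γ` (for each curve class the bad radii — discontinuity levels of the
  monotone map `r ↦ hitParam (cthickening r F)` — are countable, so a.e. level is an a.s.
  continuity level of the stopping map; continuous-mapping theorem).

Composition `SeqLimitTargetIndependent_of` (real proof, the measure theory done HERE): SLE_κ laws
in every Dobrushin domain from `LIMSEQ` and the LANDED existence of admissible families
(`…LagHandOff.HittingTournament.stub_discretisable`); uniqueness of the SLE_κ law
(`IsSLELaw.unique`, `IsSLECurve.map_eq_holds`) identifies the family on the two chords with the
laws of the limit curves `Γ₁, Γ₂` of the hands-off pair; for every `n` a radius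
`r n ∈ (0, 1/(n+1))` good for BOTH families is picked off the two null sets (`exists_seq_good`);
the stopped laws of `Γ₁, Γ₂` on `cthickening (r n) (D.arc 1)` agree (limits of eventually equal
sequences, `ext_of_forall_integral_eq_of_IsFiniteMeasure`), and the tree's
`measure_preimage_stopAt_eq_of_shrinking` (closed sets shrinking to `D.arc 1`) passes the
agreement to `stopAt (D.arc 1)`: target independence.
-/

noncomputable section

namespace Summit.CriticalPhenomena.CardyFormulaZ2.Cruxes.CardyRigiditySeq.BirthSeqLimitTargetIndependent

open scoped NNReal Topology ENNReal
open MeasureTheory Filter Set Metric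
open Literature.Probability.RandomPlanarGeometry Literature.Probability.LatticeModels
open Literature.Probability.Percolation (bondPercolation half BondConfig measurable_bondInterfaceIn)

/-- Piece X₃ of the split of `CardyRigiditySeq`, restated VERBATIM from the strategist's
children.json. -/
def SeqLimitTargetIndependent : Prop :=
  ∀ (u : ℕ → ℝ) (κ : NNReal), 0 < κ → Filter.Tendsto u Filter.atTop (nhdsWithin 0 (Set.Ioi 0)) → (∀ (D : Literature.Probability.RandomPlanarGeometry.DobrushinDomain) (E : ℝ → Literature.Probability.LatticeModels.DiscreteDobrushin), Literature.Probability.LatticeModels.ZdDiscretisationFamily D E → ∃ Γ : (NNReal → ℝ) → Literature.Probability.RandomPlanarGeometry.CurveClass ℂ, Literature.Probability.RandomPlanarGeometry.IsSLECurve κ D Γ ∧ ∀ g : BoundedContinuousFunction (Literature.Probability.RandomPlanarGeometry.CurveClass ℂ) ℝ, Filter.Tendsto (fun k ↦ ∫ ω, g (Literature.Probability.Percolation.bondInterfaceIn D (E (u k)) ω) ∂(Literature.Probability.Percolation.bondPercolation (Literature.Probability.LatticeModels.zdGraph 2) Literature.Probability.Percolation.half)) Filter.atTop (nhds (∫ ω,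 g (Γ ω) ∂Literature.Probability.Process.preWienerMeasure))) → ∃ Q : Literature.Probability.RandomPlanarGeometry.ChordalFamily, (∀ D : Literature.Probability.RandomPlanarGeometry.DobrushinDomain, Literature.Probability.RandomPlanarGeometry.IsSLELaw κ D (Q D)) ∧ Q.IsTargetIndependent

/-- STUB A — **hands-off pairs: exact lattice splitting before the thickened far arc** (LSW
locality at the lattice level; size M/L). -/
protected theorem Holds.stub_handsOffThickSplitting :
    ∀ (D : Literature.Probability.RandomPlanarGeometry.MarkedDomain 3), ∃ (E₁ E₂ : ℝ → Literature.Probability.LatticeModels.DiscreteDobrushin), Literature.Probability.LatticeModels.ZdDiscretisationFamily (D.chord 0 1 (by decide)) E₁ ∧ Literature.Probability.LatticeModels.ZdDiscretisationFamily (D.chord 0 2 (by decide)) E₂ ∧ ∀ r : ℝ, 0 < r → ∀ᶠ δ in nhdsWithin (0:ℝ) (Set.Ioi 0), MeasureTheory.Measure.map (fun ω ↦ Literature.Probability.RandomPlanarGeometry.CurveClass.stopAt (Metric.cthickening r (D.arc 1)) (Literature.Probability.Percolation.bondInterfaceIn (D.chord 0 1 (by decide)) (E₁ δ) ω)) (Literature.Probability.Percolation.bondPercolation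 (Literature.Probability.LatticeModels.zdGraph 2) Literature.Probability.Percolation.half) = MeasureTheory.Measure.map (fun ω ↦ Literature.Probability.RandomPlanarGeometry.CurveClass.stopAt (Metric.cthickening r (D.arc 1)) (Literature.Probability.Percolation.bondInterfaceIn (D.chord 0 2 (by decide)) (E₂ δ) ω)) (Literature.Probability.Percolation.bondPercolation (Literature.Probability.LatticeModels.zdGraph 2) Literature.Probability.Percolation.half) := by
  sorry

/-- By-name handle of the registered stub `Holds.stub_handsOffThickSplitting`. -/
def stub_handsOffThickSplitting : Prop := type_of% Holds.stub_handsOffThickSplitting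

/-- STUB B — **stopped laws converge at almost every thickening level** (curve-space measure
theory: a.e. level of `r ↦ hitParam (cthickening r F)` is an a.s. continuity level of the stopping
map; continuous mapping along `u`; size L). -/
protected theorem Holds.stub_stoppedLawsConverge :
    ∀ (u : ℕ → ℝ) (κ : NNReal), 0 < κ → Filter.Tendsto u Filter.atTop (nhdsWithin 0 (Set.Ioi 0)) → ∀ (D : Literature.Probability.RandomPlanarGeometry.DobrushinDomain) (E : ℝ → Literature.Probability.LatticeModels.DiscreteDobrushin), Literature.Probability.LatticeModels.ZdDiscretisationFamily D E → ∀ Γ : (NNReal → ℝ) → Literature.Probability.RandomPlanarGeometry.CurveClass ℂ, Literature.Probability.RandomPlanarGeometry.IsSLECurve κ D Γ → (∀ g : BoundedContinuousFunction (Literature.Probability.RandomPlanarGeometry.CurveClass ℂ) ℝ, Filter.Tendsto (fun k ↦ ∫ ω, g (Literature.Probability.Percolation.bondInterfaceIn D (E (u k)) ω) ∂(Literature.Probability.Percolation.bondPercolation (Literature.Probability.LatticeModels.zdGraph 2) Literature.Probability.Percolation.half)) Filter.atTop (nhds (∫ ω, g (Γ ω) ∂Literature.Probability.Process.preWienerMeasure)))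 → ∀ F : Set ℂ, IsClosed F → ∀ᵐ (r : ℝ) ∂MeasureTheory.volume, 0 < r → ∀ g : BoundedContinuousFunction (Literature.Probability.RandomPlanarGeometry.CurveClass ℂ) ℝ, Filter.Tendsto (fun k ↦ ∫ ω, g (Literature.Probability.RandomPlanarGeometry.CurveClass.stopAt (Metric.cthickening r F) (Literature.Probability.Percolation.bondInterfaceIn D (E (u k)) ω)) ∂(Literature.Probability.Percolation.bondPercolation (Literature.Probability.LatticeModels.zdGraph 2) Literature.Probability.Percolation.half)) Filter.atTop (nhds (∫ ω, g (Literature.Probability.RandomPlanarGeometry.CurveClass.stopAt (Metric.cthickening r F) (Γ ω)) ∂Literature.Probability.Process.preWienerMeasure)) := by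
  sorry

/-- By-name handle of the registered stub `Holds.stub_stoppedLawsConverge`. -/
def stub_stoppedLawsConverge : Prop := type_of% Holds.stub_stoppedLawsConverge

/-- From two Lebesgue-a.e. properties on `ℝ` pick, for every `n`, a radius in `(0, 1/(n+1))`
enjoying both. -/
theorem exists_seq_good {P₁ P₂ : ℝ → Prop} (h₁ : ∀ᵐ (r : ℝ) ∂volume, P₁ r)
    (h₂ : ∀ᵐ (r : ℝ) ∂volume, P₂ r) :
    ∃ r : ℕ → ℝ, ∀ n : ℕ, r n ∈ Ioo (0 : ℝ) (1 / ((n : ℝ) + 1)) ∧ P₁ (r n) ∧ P₂ (r n) := by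
  have key : ∀ n : ℕ, ∃ x, x ∈ Ioo (0 : ℝ) (1 / ((n : ℝ) + 1)) ∧ P₁ x ∧ P₂ x := by
    intro n
    have hε : (0 : ℝ) < 1 / ((n : ℝ) + 1) := by positivity
    have hne : volume.restrict (Ioo (0 : ℝ) (1 / ((n : ℝ) + 1))) ≠ 0 := by
      intro h0
      have h1 : volume.restrict (Ioo (0 : ℝ) (1 / ((n : ℝ) + 1))) univ = 0 := by
        rw [h0]; simp
      rw [Measure.restrict_apply_univ, Real.volume_Ioo, sub_zero, ENNReal.ofReal_eq_zero] at h1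
      linarith
    haveI : (ae (volume.restrict (Ioo (0 : ℝ) (1 / ((n : ℝ) + 1))))).NeBot := ae_neBot.2 hne
    have hmem : ∀ᵐ x ∂(volume.restrict (Ioo (0 : ℝ) (1 / ((n : ℝ) + 1)))),
        x ∈ Ioo (0 : ℝ) (1 / ((n : ℝ) + 1)) := ae_restrict_mem measurableSet_Ioo
    obtain ⟨x, hx, hx₁, hx₂⟩ := (hmem.and ((ae_restrict_of_ae h₁).and (ae_restrict_of_ae h₂))).exists
    exact ⟨x, hx, hx₁, hx₂⟩
  choose r hr using key
  exact ⟨r, hr⟩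

/-- **Composition (real proof):** the two stubs imply the piece `SeqLimitTargetIndependent` BY
NAME (see the module docstring). -/
theorem SeqLimitTargetIndependent_of :
    stub_handsOffThickSplitting → stub_stoppedLawsConverge → SeqLimitTargetIndependent := by
  intro hA hB
  dsimp only [stub_handsOffThickSplitting, stub_stoppedLawsConverge] at hA hB
  intro u κ hκ hu hlim
  classical
  haveI hWprob : IsProbabilityMeasure Literature.Probability.Process.preWienerMeasure :=
    isProbabilityMeasure_preWienerMeasure'
  -- SLE_κ laws exist in every Dobrushin domain: LIMSEQ + admissible families exist (landed theorem)
  have hex : ∀ D : DobrushinDomain, ∃ μ : Measure (CurveClass ℂ), IsSLELaw κ D μ := by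
    intro D
    obtain ⟨E, hE⟩ :=
      Summit.CriticalPhenomena.CardyFormulaZ2.Cruxes.LagHandOff.HittingTournament.stub_discretisable D
    obtain ⟨Γ, hΓ, -⟩ := hlim D E hE
    exact ⟨_, hΓ.isSLELaw_map⟩
  choose Q hQ using hex
  refine ⟨Q, hQ, ?_⟩
  intro D T hT
  -- the hands-off pair and its two limit curves
  obtain ⟨E₁, E₂, hE₁, hE₂, hsplit⟩ := hA D
  obtain ⟨Γ₁, hΓ₁, hc₁⟩ := hlim _ E₁ hE₁
  obtain ⟨Γ₂, hΓ₂, hc₂⟩ := hlim _ E₂ hE₂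
  have hQ₁ : Q (D.chord 0 1 (by decide)) = Literature.Probability.Process.preWienerMeasure.map Γ₁ :=
    IsSLELaw.unique IsSLECurve.map_eq_holds (hQ _) hΓ₁.isSLELaw_map
  have hQ₂ : Q (D.chord 0 2 (by decide)) = Literature.Probability.Process.preWienerMeasure.map Γ₂ :=
    IsSLELaw.unique IsSLECurve.map_eq_holds (hQ _) hΓ₂.isSLELaw_map
  rw [hQ₁, hQ₂]
  have hF : IsClosed (D.arc 1) := D.isClosed_arc 1
  -- radii good for both families, `r n ∈ (0, 1/(n+1))`
  obtain ⟨r, hr⟩ := exists_seq_good (hB u κ hκ hu _ E₁ hE₁ Γ₁ hΓ₁ hc₁ (D.arc 1) hF)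
    (hB u κ hκ hu _ E₂ hE₂ Γ₂ hΓ₂ hc₂ (D.arc 1) hF)
  -- the stopping sets `cthickening (r n) (D.arc 1)` are closed, contain the arc and shrink to it
  have hS : ∀ n, IsClosed (cthickening (r n) (D.arc 1)) := fun n ↦ isClosed_cthickening
  have hFS : ∀ n, D.arc 1 ⊆ cthickening (r n) (D.arc 1) := fun n ↦ self_subset_cthickening _
  have hr0 : Tendsto r atTop (𝓝 0) :=
    tendsto_of_tendsto_of_tendsto_of_le_of_le tendsto_const_nhds
      tendsto_one_div_add_atTop_nhds_zero_nat (fun n ↦ (hr n).1.1.le) (fun n ↦ (hr n).1.2.le)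
  have hshrink : ∀ φ : ℕ → ℕ, Tendsto φ atTop atTop → ∀ z : ℕ → ℂ,
      (∀ k, z k ∈ cthickening (r (φ k)) (D.arc 1)) → ∀ x : ℂ, Tendsto z atTop (𝓝 x) → x ∈ D.arc 1 := by
    intro φ hφ z hz x hx
    rw [Metric.mem_iff_infEDist_zero_of_closed hF]
    refine le_antisymm ?_ zero_le
    have h1 : Tendsto (fun k ↦ Metric.infEDist (z k) (D.arc 1)) atTop
        (𝓝 (Metric.infEDist x (D.arc 1))) :=
      (Metric.continuous_infEDist.tendsto x).comp hx
    have h2 : Tendsto (fun k ↦ ENNReal.ofReal (r (φ k))) atTop (𝓝 0) := by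
      simpa using ENNReal.tendsto_ofReal (hr0.comp hφ)
    exact le_of_tendsto_of_tendsto' h1 h2 fun k ↦ mem_cthickening_iff.1 (hz k)
  have hmS : ∀ n, Measurable (CurveClass.stopAt (cthickening (r n) (D.arc 1)) :
      CurveClass ℂ → CurveClass ℂ) := fun n ↦ CurveClass.measurable_stopAt (hS n)
  -- the stopped laws of `Γ₁`, `Γ₂` agree on every `cthickening (r n) (D.arc 1)`
  have hEq : ∀ (n : ℕ) (T' : Set (CurveClass ℂ)), MeasurableSet T' →
      (Literature.Probability.Process.preWienerMeasure.map Γ₁)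
          (CurveClass.stopAt (cthickening (r n) (D.arc 1)) ⁻¹' T') =
        (Literature.Probability.Process.preWienerMeasure.map Γ₂)
          (CurveClass.stopAt (cthickening (r n) (D.arc 1)) ⁻¹' T') := by
    intro n T' hT'
    have hG₁ := (hr n).2.1 (hr n).1.1
    have hG₂ := (hr n).2.2 (hr n).1.1
    have hlaw : Literature.Probability.Process.preWienerMeasure.map
          (CurveClass.stopAt (cthickening (r n) (D.arc 1)) ∘ Γ₁) =
        Literature.Probability.Process.preWienerMeasure.map
          (CurveClass.stopAt (cthickening (r n) (D.arc 1)) ∘ Γ₂) := by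
      refine ext_of_forall_integral_eq_of_IsFiniteMeasure fun g ↦ ?_
      rw [integral_map ((hmS n).comp_aemeasurable hΓ₁.aemeasurable) g.continuous.aestronglyMeasurable,
        integral_map ((hmS n).comp_aemeasurable hΓ₂.aemeasurable) g.continuous.aestronglyMeasurable]
      simp only [Function.comp_apply]
      refine tendsto_nhds_unique_of_eventuallyEq (hG₁ g) (hG₂ g) ?_
      filter_upwards [hu.eventually (hsplit (r n) (hr n).1.1)] with k hk
      have hm₁ : AEMeasurable (fun ω ↦ CurveClass.stopAt (cthickening (r n) (D.arc 1))
          (Literature.Probability.Percolation.bondInterfaceIn (D.chord 0 1 (by decide)) (E₁ (u k)) ω))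
          (bondPercolation (zdGraph 2) half) :=
        ((hmS n).comp (measurable_bondInterfaceIn _ _)).aemeasurable
      have hm₂ : AEMeasurable (fun ω ↦ CurveClass.stopAt (cthickening (r n) (D.arc 1))
          (Literature.Probability.Percolation.bondInterfaceIn (D.chord 0 2 (by decide)) (E₂ (u k)) ω))
          (bondPercolation (zdGraph 2) half) :=
        ((hmS n).comp (measurable_bondInterfaceIn _ _)).aemeasurable
      have e₁ : ∫ γ, g γ ∂((bondPercolation (zdGraph 2) half).map (fun ω ↦
            CurveClass.stopAt (cthickening (r n) (D.arc 1))
              (Literature.Probability.Percolation.bondInterfaceIn (D.chord 0 1 (by decide)) (E₁ (u k)) ω))) =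
          ∫ ω, g (CurveClass.stopAt (cthickening (r n) (D.arc 1))
            (Literature.Probability.Percolation.bondInterfaceIn (D.chord 0 1 (by decide)) (E₁ (u k)) ω))
            ∂(bondPercolation (zdGraph 2) half) :=
        integral_map hm₁ g.continuous.aestronglyMeasurable
      have e₂ : ∫ γ, g γ ∂((bondPercolation (zdGraph 2) half).map (fun ω ↦
            CurveClass.stopAt (cthickening (r n) (D.arc 1))
              (Literature.Probability.Percolation.bondInterfaceIn (D.chord 0 2 (by decide)) (E₂ (u k)) ω))) =
          ∫ ω, g (CurveClass.stopAt (cthickening (r n) (D.arc 1))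
            (Literature.Probability.Percolation.bondInterfaceIn (D.chord 0 2 (by decide)) (E₂ (u k)) ω))
            ∂(bondPercolation (zdGraph 2) half) :=
        integral_map hm₂ g.continuous.aestronglyMeasurable
      rw [← e₁, ← e₂, hk]
    have h := congrArg (fun ρ : Measure (CurveClass ℂ) ↦ ρ T') hlaw
    rw [Measure.map_apply_of_aemeasurable ((hmS n).comp_aemeasurable hΓ₁.aemeasurable) hT',
      Measure.map_apply_of_aemeasurable ((hmS n).comp_aemeasurable hΓ₂.aemeasurable) hT'] at h
    rw [Measure.map_apply_of_aemeasurable hΓ₁.aemeasurable ((hmS n) hT'),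
      Measure.map_apply_of_aemeasurable hΓ₂.aemeasurable ((hmS n) hT')]
    exact h
  exact measure_preimage_stopAt_eq_of_shrinking hF hS hFS hshrink hEq hT

/-- The piece, conditionally on the two registered stubs (the only `sorry`s of this file are
inside `Holds.stub_*`). -/
theorem seqLimitTargetIndependent_of_stubs : SeqLimitTargetIndependent :=
  SeqLimitTargetIndependent_of Holds.stub_handsOffThickSplitting Holds.stub_stoppedLawsConverge

end Summit.CriticalPhenomena.CardyFormulaZ2.Cruxes.CardyRigiditySeq.BirthSeqLimitTargetIndependent

end
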